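import Literature.Geometry.Riemannian.MetricFlowCorrespondenceChainAux
import Literature.Geometry.Riemannian.MetricFlowCorrespondence
import Mathlib.Topology.MetricSpace.Completion
import HarnessLib

/-!
# A chain of correspondences becomes one correspondence between all the flows, with complete
# separable comparison spaces (Bamler 2023, §5.4, proof of Thm. 5.19)

R. Bamler, *Compactness theory of the space of super Ricci flows*, Invent. Math. 233 (2023), §5.4,
proof of Theorem 5.19 (arXiv v1 Thm. 120, completeness of `(𝔽^J_I, d^J_𝔽)`): *"So we can find
correspondences `ℭ^{i,i+1}` between `𝒳^i, 𝒳^{i+1}` over `I` that are fully defined over `J` such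
that `d_𝔽^{ℭ^{i,i+1},J}(𝒳^i, 𝒳^{i+1}) < 2^{-i}`. By an iterative application of Lemma 5.15 [arXiv
v1 Lemma 114], we can construct sequences of correspondences `ℭ^{1…k}` between `𝒳¹, …, 𝒳ᵏ` such
that for any `1 ≤ i < k`, `d_𝔽^{ℭ^{1…k},J}(𝒳^i, 𝒳^{i+1}) = d_𝔽^{ℭ^{i,i+1},J}(𝒳^i, 𝒳^{i+1})`.
Using a direct limit construction on the sequence of metric spaces `(Z^{1…k}_t, d^{Z^{1…k}}_t)`,
we find a correspondence `ℭ` between `𝒳¹, 𝒳², …` such that for any `i ∈ ℕ`,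
`d_𝔽^{ℭ,J}(𝒳^i, 𝒳^{i+1}) = d_𝔽^{ℭ^{i,i+1},J}(𝒳^i, 𝒳^{i+1}) < 2^{-i}`. After passing to their
completions, we may assume that the metric spaces `(Z_t, d^Z_t)` of the correspondence `ℭ` are
complete."* (Lemma 5.20 is then applied within `ℭ`; its tree version also wants `Z_t` separable.)

This file proves that step in the tree's vocabulary (`MetricFlow.Correspondence₂`,
`MetricFlow.FamilyCorrespondence`, `MetricFlowPair.FDistAdmissible`): from a chain
`ℭ n : Correspondence₂ (P n).flow (P (n + 1)).flow I₀` of two-flow correspondences it builds ONE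
correspondence `MetricFlowPair.chainCorrespondence ℭ : FamilyCorrespondence (fun n ↦ (P n).flow) I₀`
between all the flows. For each `t ∈ I₀` separately: the chain `Z⁰_t ⊇ 𝒳¹_t ⊆ Z¹_t ⊇ 𝒳²_t ⊆ …`
(`Zⁿ_t := (ℭ n).Z t`, the slice `𝒳^{n+1}_t` sitting in `Zⁿ_t` by `φ^{n,2}_t` and in `Z^{n+1}_t` by
`φ^{n+1,1}_t` whenever `t ∈ I''^{n,2} ∩ I''^{n+1,1}`) is glued iteratively and passed to the direct
limit (`MetricChainGlue.Limit`, file `MetricFlowCorrespondenceChainAux.lean`: Mathlib's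
`Metric.GlueSpace` / `Metric.InductiveLimit`, disjoint unions where nothing is to be glued), then
completed (`UniformSpace.Completion`), and `Z_t := MetricFlowPair.Chain.Space ℭ t` is the closure
of the union of all slice images therein — a complete AND separable metric space (slices are
separable), with its Borel σ-algebra. Domains: `I''^{,n} := I''^{n,1} ∪ I''^{n-1,2}`
(`Chain.dom`); embeddings `φⁿ_t` (`Chain.φ`): through `φ^{n,1}_t` if `t ∈ I''^{n,1}`, else through
`φ^{n-1,2}_t` — the two agree on the overlap (`Chain.emb₁_succ_eq_emb₂`, from
`Metric.toGlue_commute`). Main results: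

* `kernelDistWithin_chainCorrespondence_pair` — the integrand of `d_𝔽^{ℭ,J}(𝒳ⁿ, 𝒳ⁿ⁺¹)` for the
  pair correspondence `(chainCorrespondence ℭ).pair n (n + 1)` EQUALS that of `ℭ n` pointwise
  (`d_{W₁}` of push-forwards only depends on the mutual distances of the two embeddings,
  `wassersteinW1_map_map_eq_of_edist_eq`), whence
  `FDistAdmissible.chainCorrespondence_pair` (every admissible `(r, E, q)` for `ℭ n` is admissible
  for the pair correspondence) and `fDistWithin_chainCorrespondence_pair_le`
  (`d_𝔽^{ℭ,J}(𝒳ⁿ, 𝒳ⁿ⁺¹) ≤ d_𝔽^{ℭⁿ,J}(𝒳ⁿ, 𝒳ⁿ⁺¹)`);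
* `exists_familyCorrespondence_of_chain` — the registered packaging: a correspondence between all
  `(P n).flow` over `I₀` with complete separable comparison spaces, fully defined over `J` if all
  `ℭ n` are, with `I''^{n,1} ⊆ I''^{,n}`, `I''^{n,2} ⊆ I''^{,n+1}`, transferring admissibility.

## References

* R. H. Bamler, *Compactness theory of the space of super Ricci flows*, Invent. Math. 233 (2023),
  1121–1277 (arXiv:2008.09298), §5.2, Lemma 5.15 (arXiv v1 Lemma 114); §5.4, proof of
  Thm. 5.19 (arXiv v1 Thm. 120). [Bamler2023]
-/

noncomputable section

open Set MeasureTheory Filter TopologicalSpace Function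
open scoped Topology ENNReal NNReal

namespace Literature.Geometry.Riemannian

universe u

namespace MetricFlowPair

open MetricFlow

variable {I₀ : Set ℝ} {P : ℕ → MetricFlowPair.{u} I₀}
  (ℭ : ∀ n, Correspondence₂ (P n).flow (P (n + 1)).flow I₀)

namespace Chain

/-! ### The comparison space `Z_t` -/

/-- The gluing of `Zⁿ_t` and `Zⁿ⁺¹_t` along `𝒳ⁿ⁺¹_t` is active iff both middle embeddings exist:
`t ∈ I''^{n,2} ∩ I''^{n+1,1}`. [cite: Bamler2023, §5.2, Lemma 5.15 (arXiv v1 Lemma 114)] -/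
def Act (t : I₀) (n : ℕ) : Prop :=
  (t : ℝ) ∈ (ℭ n).dom₂ ∧ (t : ℝ) ∈ (ℭ (n + 1)).dom₁

/-- The hub of the `n`-th gluing: the slice `𝒳ⁿ⁺¹_t`. [cite: Bamler2023, §5.2, Lemma 5.15] -/
abbrev Hub (t : I₀) (n : ℕ) (h : Act ℭ t n) : Type u :=
  (P (n + 1)).flow.Slice ⟨t, ((ℭ (n + 1)).dom₁_subset h.2).1⟩

/-- The copy `φ^{n,2}_t` of the hub in `Zⁿ_t`. [cite: Bamler2023, §5.2, Lemma 5.15 (arXiv v1 Lemma 114)] -/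
def hubL (t : I₀) (n : ℕ) (h : Act ℭ t n) : Hub ℭ t n h → (ℭ n).Z t :=
  (ℭ n).φ₂ t h.1

/-- The copy `φ^{n+1,1}_t` of the hub in `Zⁿ⁺¹_t`. [cite: Bamler2023, §5.2, Lemma 5.15 (arXiv v1 Lemma 114)] -/
def hubR (t : I₀) (n : ℕ) (h : Act ℭ t n) : Hub ℭ t n h → (ℭ (n + 1)).Z t :=
  (ℭ (n + 1)).φ₁ t h.2

/-- `φ^{n,2}_t` is an isometric embedding. [cite: Bamler2023, §5.2, Lemma 5.15 (arXiv v1 Lemma 114)] -/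
theorem isometry_hubL (t : I₀) (n : ℕ) (h : Act ℭ t n) : Isometry (hubL ℭ t n h) :=
  (ℭ n).isometry₂ t h.1

/-- `φ^{n+1,1}_t` is an isometric embedding. [cite: Bamler2023, §5.2, Lemma 5.15 (arXiv v1 Lemma 114)] -/
theorem isometry_hubR (t : I₀) (n : ℕ) (h : Act ℭ t n) : Isometry (hubR ℭ t n h) :=
  (ℭ (n + 1)).isometry₁ t h.2

/-- The direct limit of the iterated gluings `Z⁰_t ∪_{𝒳¹_t} Z¹_t ∪_{𝒳²_t} Z²_t ∪ …`.
[cite: Bamler2023, §5.4, proof of Thm. 5.19 (arXiv v1 Thm. 120)] -/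
abbrev Lim (t : I₀) : Type u :=
  MetricChainGlue.Limit (isometry_hubL ℭ t) (isometry_hubR ℭ t)

/-- **The isometric copy `ιⁿ_t : Zⁿ_t → Ẑ_t` of the `n`-th comparison space in the completed
direct limit.** [cite: Bamler2023, §5.4, proof of Thm. 5.19 (arXiv v1 Thm. 120)] -/
def toLim (t : I₀) (n : ℕ) : (ℭ n).Z t → UniformSpace.Completion (Lim ℭ t) :=
  (↑) ∘ MetricChainGlue.ι (isometry_hubL ℭ t) (isometry_hubR ℭ t) n

/-- `ιⁿ_t` is an isometric embedding. [cite: Bamler2023, §5.4, proof of Thm. 5.19 (arXiv v1 Thm. 120)] -/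
theorem isometry_toLim (t : I₀) (n : ℕ) : Isometry (toLim ℭ t n) :=
  UniformSpace.Completion.coe_isometry.comp (MetricChainGlue.isometry_ι _ _ n)

/-- **The copies of `𝒳ⁿ⁺¹_t` agree**: `ιⁿ_t ∘ φ^{n,2}_t = ιⁿ⁺¹_t ∘ φ^{n+1,1}_t` on `𝒳ⁿ⁺¹_t` for
`t ∈ I''^{n,2} ∩ I''^{n+1,1}` (identity (5.13) of Lemma 5.15).
[cite: Bamler2023, §5.2, Lemma 5.15 (arXiv v1 Lemma 114, (5.13))] -/
theorem toLim_comm (t : I₀) (n : ℕ) (h₂ : (t : ℝ) ∈ (ℭ n).dom₂) (h₁ : (t : ℝ) ∈ (ℭ (n + 1)).dom₁)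
    (y : (P (n + 1)).flow.Slice ⟨t, ((ℭ n).dom₂_subset h₂).1⟩) :
    toLim ℭ t n ((ℭ n).φ₂ t h₂ y) = toLim ℭ t (n + 1) ((ℭ (n + 1)).φ₁ t h₁ y) :=
  congrArg ((↑) : Lim ℭ t → UniformSpace.Completion (Lim ℭ t))
    (MetricChainGlue.ι_comm (isometry_hubL ℭ t) (isometry_hubR ℭ t) n ⟨h₂, h₁⟩ y)

/-- The union of all slice images `ιⁿ_t (φ^{n,1}_t (𝒳ⁿ_t))`, `ιⁿ_t (φ^{n,2}_t (𝒳ⁿ⁺¹_t))` in the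
completed direct limit. [cite: Bamler2023, §5.4, proof of Thm. 5.19 (arXiv v1 Thm. 120)] -/
def core (t : I₀) : Set (UniformSpace.Completion (Lim ℭ t)) :=
  ⋃ n, ((⋃ h : (t : ℝ) ∈ (ℭ n).dom₁, range (toLim ℭ t n ∘ (ℭ n).φ₁ t h)) ∪
    ⋃ h : (t : ℝ) ∈ (ℭ n).dom₂, range (toLim ℭ t n ∘ (ℭ n).φ₂ t h))

/-- The union of the slice images is separable (countably many images of separable slices).
[cite: Bamler2023, §5.4, proof of Thm. 5.19 (arXiv v1 Thm. 120)] -/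
theorem isSeparable_core (t : I₀) : IsSeparable (core ℭ t) :=
  .iUnion fun n ↦ .union
    (.iUnion fun h ↦ isSeparable_range
      ((isometry_toLim ℭ t n).continuous.comp ((ℭ n).isometry₁ t h).continuous))
    (.iUnion fun h ↦ isSeparable_range
      ((isometry_toLim ℭ t n).continuous.comp ((ℭ n).isometry₂ t h).continuous))

/-- **The comparison space `Z_t`** of the combined correspondence: the closure of the union of all
slice images inside the completion of the direct limit of the iterated gluings.
[cite: Bamler2023, §5.4, proof of Thm. 5.19 (arXiv v1 Thm. 120)] -/
def Space (t : I₀) : Type u :=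
  ↥(closure (core ℭ t))

/-- `Z_t` is a metric subspace of the completed limit. [cite: Bamler2023, §5.4, proof of Thm. 5.19] -/
instance instMetricSpace (t : I₀) : MetricSpace (Space ℭ t) :=
  inferInstanceAs (MetricSpace ↥(closure (core ℭ t)))

/-- `Z_t` is complete (closed in the completion). [cite: Bamler2023, §5.4, proof of Thm. 5.19] -/
instance instCompleteSpace (t : I₀) : CompleteSpace (Space ℭ t) :=
  isClosed_closure.completeSpace_coe

/-- `Z_t` is separable (closure of a separable set). [cite: Bamler2023, §5.4, proof of Thm. 5.19] -/
instance instSeparableSpace (t : I₀) : SeparableSpace (Space ℭ t) :=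
  (isSeparable_core ℭ t).closure.separableSpace

/-- `Z_t` carries its Borel σ-algebra. [cite: Bamler2023, §5.1, Def. 5.5 (Correspondence)] -/
instance instMeasurableSpace (t : I₀) : MeasurableSpace (Space ℭ t) := borel _

/-- The σ-algebra of `Z_t` is the Borel one. [cite: Bamler2023, §5.1, Def. 5.5 (Correspondence)] -/
instance instBorelSpace (t : I₀) : BorelSpace (Space ℭ t) := ⟨rfl⟩

/-! ### The embeddings -/

/-- `ιⁿ_t (φ^{n,1}_t x) ∈ Z_t`. [cite: Bamler2023, §5.4, proof of Thm. 5.19 (arXiv v1 Thm. 120)] -/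
theorem mem₁ (n : ℕ) (t : ℝ) (h : t ∈ (ℭ n).dom₁)
    (x : (P n).flow.Slice ⟨t, ((ℭ n).dom₁_subset h).1⟩) :
    toLim ℭ ⟨t, ((ℭ n).dom₁_subset h).2⟩ n ((ℭ n).φ₁ t h x) ∈
      closure (core ℭ ⟨t, ((ℭ n).dom₁_subset h).2⟩) :=
  subset_closure (mem_iUnion.2 ⟨n, mem_union_left _ (mem_iUnion.2 ⟨h, x, rfl⟩)⟩)

/-- `ιⁿ_t (φ^{n,2}_t y) ∈ Z_t`. [cite: Bamler2023, §5.4, proof of Thm. 5.19 (arXiv v1 Thm. 120)] -/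
theorem mem₂ (n : ℕ) (t : ℝ) (h : t ∈ (ℭ n).dom₂)
    (y : (P (n + 1)).flow.Slice ⟨t, ((ℭ n).dom₂_subset h).1⟩) :
    toLim ℭ ⟨t, ((ℭ n).dom₂_subset h).2⟩ n ((ℭ n).φ₂ t h y) ∈
      closure (core ℭ ⟨t, ((ℭ n).dom₂_subset h).2⟩) :=
  subset_closure (mem_iUnion.2 ⟨n, mem_union_right _ (mem_iUnion.2 ⟨h, y, rfl⟩)⟩)

/-- **`ιⁿ_t ∘ φ^{n,1}_t : 𝒳ⁿ_t → Z_t`** (`t ∈ I''^{n,1}`).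
[cite: Bamler2023, §5.2, Lemma 5.15 (arXiv v1 Lemma 114, (5.13))] -/
def emb₁ (n : ℕ) (t : ℝ) (h : t ∈ (ℭ n).dom₁) :
    (P n).flow.Slice ⟨t, ((ℭ n).dom₁_subset h).1⟩ → Space ℭ ⟨t, ((ℭ n).dom₁_subset h).2⟩ :=
  fun x ↦ Subtype.mk _ (mem₁ ℭ n t h x)

/-- **`ιⁿ_t ∘ φ^{n,2}_t : 𝒳ⁿ⁺¹_t → Z_t`** (`t ∈ I''^{n,2}`).
[cite: Bamler2023, §5.2, Lemma 5.15 (arXiv v1 Lemma 114, (5.13))] -/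
def emb₂ (n : ℕ) (t : ℝ) (h : t ∈ (ℭ n).dom₂) :
    (P (n + 1)).flow.Slice ⟨t, ((ℭ n).dom₂_subset h).1⟩ → Space ℭ ⟨t, ((ℭ n).dom₂_subset h).2⟩ :=
  fun y ↦ Subtype.mk _ (mem₂ ℭ n t h y)

/-- `ιⁿ_t ∘ φ^{n,1}_t` is an isometric embedding. [cite: Bamler2023, §5.2, Lemma 5.15 (arXiv v1 Lemma 114)] -/
theorem isometry_emb₁ (n : ℕ) (t : ℝ) (h : t ∈ (ℭ n).dom₁) : Isometry (emb₁ ℭ n t h) :=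
  fun x y ↦ ((isometry_toLim ℭ _ n).comp ((ℭ n).isometry₁ t h)).edist_eq x y

/-- `ιⁿ_t ∘ φ^{n,2}_t` is an isometric embedding. [cite: Bamler2023, §5.2, Lemma 5.15 (arXiv v1 Lemma 114)] -/
theorem isometry_emb₂ (n : ℕ) (t : ℝ) (h : t ∈ (ℭ n).dom₂) : Isometry (emb₂ ℭ n t h) :=
  fun x y ↦ ((isometry_toLim ℭ _ n).comp ((ℭ n).isometry₂ t h)).edist_eq x y

/-- **Distances between `𝒳ⁿ_t` and `𝒳ⁿ⁺¹_t` in `Z_t` are those in `Zⁿ_t`**: both factor through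
the isometric embedding `ιⁿ_t`. [cite: Bamler2023, §5.4, proof of Thm. 5.19 (arXiv v1 Thm. 120)] -/
theorem edist_emb₁_emb₂ (n : ℕ) (t : ℝ) (h₁ : t ∈ (ℭ n).dom₁) (h₂ : t ∈ (ℭ n).dom₂)
    (x : (P n).flow.Slice ⟨t, ((ℭ n).dom₁_subset h₁).1⟩)
    (y : (P (n + 1)).flow.Slice ⟨t, ((ℭ n).dom₂_subset h₂).1⟩) :
    edist (emb₁ ℭ n t h₁ x) (emb₂ ℭ n t h₂ y) = edist ((ℭ n).φ₁ t h₁ x) ((ℭ n).φ₂ t h₂ y) :=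
  (isometry_toLim ℭ _ n).edist_eq _ _

/-- **On the overlap the two recipes agree**: `ιⁿ⁺¹_t ∘ φ^{n+1,1}_t = ιⁿ_t ∘ φ^{n,2}_t` on
`𝒳ⁿ⁺¹_t` for `t ∈ I''^{n+1,1} ∩ I''^{n,2}` (the gluing identifies the two copies).
[cite: Bamler2023, §5.2, Lemma 5.15 (arXiv v1 Lemma 114, (5.13))] -/
theorem emb₁_succ_eq_emb₂ (n : ℕ) (t : ℝ) (h₁ : t ∈ (ℭ (n + 1)).dom₁) (h₂ : t ∈ (ℭ n).dom₂) :
    emb₁ ℭ (n + 1) t h₁ = emb₂ ℭ n t h₂ :=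
  funext fun y ↦ Subtype.ext (toLim_comm ℭ ⟨t, ((ℭ n).dom₂_subset h₂).2⟩ n h₂ h₁ y).symm

/-! ### Domains and embeddings of the combined correspondence -/

/-- **The domains `I''^{,n} := I''^{n,1} ∪ I''^{n-1,2}`** (`I''^{,0} := I''^{0,1}`).
[cite: Bamler2023, §5.2, Lemma 5.15 (arXiv v1 Lemma 114: `I''^{123,2} := I''^{12,2} ∪ I''^{23,2}`)] -/
def dom : ℕ → Set ℝ
  | 0 => (ℭ 0).dom₁
  | n + 1 => (ℭ (n + 1)).dom₁ ∪ (ℭ n).dom₂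

/-- `I''^{,n} ⊆ I'^{,n} ∩ I₀`. [cite: Bamler2023, §5.1, Def. 5.5 (Correspondence)] -/
theorem dom_subset : ∀ n, dom ℭ n ⊆ (P n).I' ∩ I₀
  | 0 => (ℭ 0).dom₁_subset
  | n + 1 => union_subset (ℭ (n + 1)).dom₁_subset (ℭ n).dom₂_subset

/-- `I''^{n,1} ⊆ I''^{,n}`. [cite: Bamler2023, §5.2, Lemma 5.15 (arXiv v1 Lemma 114)] -/
theorem dom₁_subset_dom : ∀ n, (ℭ n).dom₁ ⊆ dom ℭ n
  | 0 => Subset.rfl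
  | _ + 1 => subset_union_left

/-- `I''^{n,2} ⊆ I''^{,n+1}`. [cite: Bamler2023, §5.2, Lemma 5.15 (arXiv v1 Lemma 114)] -/
theorem dom₂_subset_dom (n : ℕ) : (ℭ n).dom₂ ⊆ dom ℭ (n + 1) := subset_union_right

/-- **The embeddings `φⁿ_t : 𝒳ⁿ_t → Z_t`**, `t ∈ I''^{,n}`: through `φ^{n,1}_t` if `t ∈ I''^{n,1}`,
through `φ^{n-1,2}_t` otherwise. [cite: Bamler2023, §5.2, Lemma 5.15 (arXiv v1 Lemma 114, (5.13))] -/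
def φ : ∀ (n : ℕ) (t : ℝ) (ht : t ∈ dom ℭ n),
    (P n).flow.Slice ⟨t, (dom_subset ℭ n ht).1⟩ → Space ℭ ⟨t, (dom_subset ℭ n ht).2⟩
  | 0, t, ht => emb₁ ℭ 0 t ht
  | n + 1, t, ht => by
    classical
    exact if h : t ∈ (ℭ (n + 1)).dom₁ then emb₁ ℭ (n + 1) t h
      else emb₂ ℭ n t (((mem_union _ _ _).1 ht).resolve_left h)

/-- On `I''^{n,1}`, `φⁿ_t = ιⁿ_t ∘ φ^{n,1}_t`. [cite: Bamler2023, §5.2, Lemma 5.15 (arXiv v1 Lemma 114, (5.13))] -/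
theorem φ_eq_emb₁ : ∀ (n : ℕ) (t : ℝ) (ht : t ∈ dom ℭ n) (h : t ∈ (ℭ n).dom₁),
    φ ℭ n t ht = emb₁ ℭ n t h
  | 0, _, _, _ => rfl
  | _ + 1, _, _, h => by simp only [φ, dif_pos h]

/-- On `I''^{n,2}`, `φⁿ⁺¹_t = ιⁿ_t ∘ φ^{n,2}_t`. [cite: Bamler2023, §5.2, Lemma 5.15 (arXiv v1 Lemma 114, (5.13))] -/
theorem φ_succ_eq_emb₂ (n : ℕ) (t : ℝ) (ht : t ∈ dom ℭ (n + 1)) (h : t ∈ (ℭ n).dom₂) :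
    φ ℭ (n + 1) t ht = emb₂ ℭ n t h := by
  by_cases h₁ : t ∈ (ℭ (n + 1)).dom₁
  · rw [φ_eq_emb₁ ℭ (n + 1) t ht h₁]
    exact emb₁_succ_eq_emb₂ ℭ n t h₁ h
  · simp only [φ, dif_neg h₁]

/-- Each `φⁿ_t` is an isometric embedding. [cite: Bamler2023, §5.1, Def. 5.5 (Correspondence)] -/
theorem isometry_φ : ∀ (n : ℕ) (t : ℝ) (ht : t ∈ dom ℭ n), Isometry (φ ℭ n t ht)
  | 0, t, ht => isometry_emb₁ ℭ 0 t ht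
  | n + 1, t, ht => by
    by_cases h : t ∈ (ℭ (n + 1)).dom₁
    · rw [φ_eq_emb₁ ℭ (n + 1) t ht h]
      exact isometry_emb₁ ℭ (n + 1) t h
    · rw [φ_succ_eq_emb₂ ℭ n t ht (((mem_union _ _ _).1 ht).resolve_left h)]
      exact isometry_emb₂ ℭ n t _

/-- **`d_{Z_t}(φⁿ_t x, φⁿ⁺¹_t y) = d_{Zⁿ_t}(φ^{n,1}_t x, φ^{n,2}_t y)`** for `t ∈ I''^{n,1} ∩ I''^{n,2}`.
[cite: Bamler2023, §5.4, proof of Thm. 5.19 (arXiv v1 Thm. 120)] -/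
theorem edist_φ_φ_succ (n : ℕ) (t : ℝ) (ht₁ : t ∈ dom ℭ n) (ht₂ : t ∈ dom ℭ (n + 1))
    (h₁ : t ∈ (ℭ n).dom₁) (h₂ : t ∈ (ℭ n).dom₂)
    (x : (P n).flow.Slice ⟨t, ((ℭ n).dom₁_subset h₁).1⟩)
    (y : (P (n + 1)).flow.Slice ⟨t, ((ℭ n).dom₂_subset h₂).1⟩) :
    edist (φ ℭ n t ht₁ x) (φ ℭ (n + 1) t ht₂ y) = edist ((ℭ n).φ₁ t h₁ x) ((ℭ n).φ₂ t h₂ y) := by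
  rw [φ_eq_emb₁ ℭ n t ht₁ h₁, φ_succ_eq_emb₂ ℭ n t ht₂ h₂]
  exact edist_emb₁_emb₂ ℭ n t h₁ h₂ x y

end Chain

/-! ### The combined correspondence -/

/-- **The correspondence between all the flows `𝒳ⁿ = (P n).flow`, `n ∈ ℕ`, over `I₀` obtained
from a chain of correspondences `ℭⁿ` between `𝒳ⁿ, 𝒳ⁿ⁺¹`** (iterated Lemma 5.15 + direct limit +
completion): comparison spaces `Z_t = Chain.Space ℭ t` (complete, separable, Borel), domains
`I''^{,n} = I''^{n,1} ∪ I''^{n-1,2}`, embeddings `Chain.φ`.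
[cite: Bamler2023, §5.4, proof of Thm. 5.19 (arXiv v1 Thm. 120)] -/
def chainCorrespondence : FamilyCorrespondence (fun n ↦ (P n).flow) I₀ where
  Z := Chain.Space ℭ
  dom := Chain.dom ℭ
  dom_subset := Chain.dom_subset ℭ
  φ := Chain.φ ℭ
  isometry := Chain.isometry_φ ℭ

/-- The comparison spaces `Z_t` are complete. [cite: Bamler2023, §5.4, proof of Thm. 5.19] -/
theorem completeSpace_chainCorrespondence (t : I₀) :
    CompleteSpace ((chainCorrespondence ℭ).Z t) :=
  Chain.instCompleteSpace ℭ t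

/-- The comparison spaces `Z_t` are separable. [cite: Bamler2023, §5.4, proof of Thm. 5.19] -/
theorem separableSpace_chainCorrespondence (t : I₀) :
    SeparableSpace ((chainCorrespondence ℭ).Z t) :=
  Chain.instSeparableSpace ℭ t

/-- `I''^{n,1} ⊆ I''^{,n}`. [cite: Bamler2023, §5.2, Lemma 5.15 (arXiv v1 Lemma 114)] -/
theorem dom₁_subset_chainCorrespondence_dom (n : ℕ) :
    (ℭ n).dom₁ ⊆ (chainCorrespondence ℭ).dom n :=
  Chain.dom₁_subset_dom ℭ n

/-- `I''^{n,2} ⊆ I''^{,n+1}`. [cite: Bamler2023, §5.2, Lemma 5.15 (arXiv v1 Lemma 114)] -/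
theorem dom₂_subset_chainCorrespondence_dom (n : ℕ) :
    (ℭ n).dom₂ ⊆ (chainCorrespondence ℭ).dom (n + 1) :=
  Chain.dom₂_subset_dom ℭ n

/-- The combined correspondence is fully defined over `J` as soon as all `ℭⁿ` are.
[cite: Bamler2023, §5.4, proof of Thm. 5.19 (arXiv v1 Thm. 120)] -/
theorem fullyDefinedOver_chainCorrespondence {J : Set ℝ} (hJ : ∀ n, (ℭ n).FullyDefinedOver J) :
    (chainCorrespondence ℭ).FullyDefinedOver J :=
  fun n ↦ (hJ n).1.trans (Chain.dom₁_subset_dom ℭ n)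

/-- **The integrand of `d_𝔽^{ℭ,J}(𝒳ⁿ, 𝒳ⁿ⁺¹)` within the combined correspondence equals that
within `ℭⁿ`**: for `s ≤ t` in `I''^{n,1} ∩ I''^{n,2}` and `(x, y) ∈ 𝒳ⁿ_t × 𝒳ⁿ⁺¹_t`,
`d^{Z_s}_{W₁}((φⁿ_s)_* νⁿ_{x;s}, (φⁿ⁺¹_s)_* νⁿ⁺¹_{y;s}) =
d^{Zⁿ_s}_{W₁}((φ^{n,1}_s)_* νⁿ_{x;s}, (φ^{n,2}_s)_* νⁿ⁺¹_{y;s})`, both pairs of embeddings realising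
the same mutual distances (`wassersteinW1_map_map_eq_of_edist_eq`). This is
`d_𝔽^{ℭ,J}(𝒳^i, 𝒳^{i+1}) = d_𝔽^{ℭ^{i,i+1},J}(𝒳^i, 𝒳^{i+1})` at the level of integrands.
[cite: Bamler2023, §5.4, proof of Thm. 5.19 (arXiv v1 Thm. 120)] -/
theorem kernelDistWithin_chainCorrespondence_pair (n : ℕ) {s t : ℝ} (hst : s ≤ t)
    (hs₁ : s ∈ (ℭ n).dom₁) (hs₂ : s ∈ (ℭ n).dom₂) (ht₁ : t ∈ (ℭ n).dom₁) (ht₂ : t ∈ (ℭ n).dom₂)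
    (hs₁' : s ∈ ((chainCorrespondence ℭ).pair n (n + 1)).dom₁)
    (hs₂' : s ∈ ((chainCorrespondence ℭ).pair n (n + 1)).dom₂)
    (ht₁' : t ∈ ((chainCorrespondence ℭ).pair n (n + 1)).dom₁)
    (ht₂' : t ∈ ((chainCorrespondence ℭ).pair n (n + 1)).dom₂)
    (p : (P n).flow.Slice ⟨t, ((ℭ n).dom₁_subset ht₁).1⟩ ×
      (P (n + 1)).flow.Slice ⟨t, ((ℭ n).dom₂_subset ht₂).1⟩) :
    kernelDistWithin (P n) (P (n + 1)) ((chainCorrespondence ℭ).pair n (n + 1)) hs₁' hs₂' ht₁'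
        ht₂' p =
      kernelDistWithin (P n) (P (n + 1)) (ℭ n) hs₁ hs₂ ht₁ ht₂ p := by
  haveI := (P n).flow.isProbabilityMeasure (s := ⟨s, ((ℭ n).dom₁_subset hs₁).1⟩) hst p.1
  haveI := (P (n + 1)).flow.isProbabilityMeasure (s := ⟨s, ((ℭ n).dom₂_subset hs₂).1⟩) hst p.2
  exact wassersteinW1_map_map_eq_of_edist_eq ((ℭ n).isometry₁ s hs₁) ((ℭ n).isometry₂ s hs₂)
    (Chain.isometry_φ ℭ n s hs₁') (Chain.isometry_φ ℭ (n + 1) s hs₂')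
    (Chain.edist_φ_φ_succ ℭ n s hs₁' hs₂' hs₁ hs₂) _ _

/-- **Admissibility transfers from `ℭⁿ` to the combined correspondence**: an admissible
`(r; E, (q_t))` for `d_𝔽^{ℭⁿ,J}(𝒳ⁿ, 𝒳ⁿ⁺¹)` is admissible for `d_𝔽^{ℭ,J}(𝒳ⁿ, 𝒳ⁿ⁺¹)` with the same
`E` and couplings (the domains only grow, the integrands agree).
[cite: Bamler2023, §5.4, proof of Thm. 5.19 (arXiv v1 Thm. 120)] -/
theorem FDistAdmissible.chainCorrespondence_pair {J : Set ℝ} {n : ℕ} {r : ℝ}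
    (h : FDistAdmissible (P n) (P (n + 1)) (ℭ n) J r) :
    FDistAdmissible (P n) (P (n + 1)) ((chainCorrespondence ℭ).pair n (n + 1)) J r := by
  obtain ⟨hr, E, hEm, hEI, hJE, hE₁, hE₂, hvol, q, hq, hint⟩ := h
  refine ⟨hr, E, hEm, hEI, hJE, hE₁.trans (Chain.dom₁_subset_dom ℭ n),
    hE₂.trans (Chain.dom₂_subset_dom ℭ n), hvol, q, hq, fun s hs t ht hst ↦ ?_⟩
  calc ∫⁻ p, kernelDistWithin (P n) (P (n + 1)) ((chainCorrespondence ℭ).pair n (n + 1))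
          (hE₁.trans (Chain.dom₁_subset_dom ℭ n) hs) (hE₂.trans (Chain.dom₂_subset_dom ℭ n) hs)
          (hE₁.trans (Chain.dom₁_subset_dom ℭ n) ht) (hE₂.trans (Chain.dom₂_subset_dom ℭ n) ht)
          p ∂q t ht
      = ∫⁻ p, kernelDistWithin (P n) (P (n + 1)) (ℭ n) (hE₁ hs) (hE₂ hs) (hE₁ ht) (hE₂ ht) p
          ∂q t ht :=
        lintegral_congr fun p ↦ kernelDistWithin_chainCorrespondence_pair ℭ n hst (hE₁ hs)
          (hE₂ hs) (hE₁ ht) (hE₂ ht) _ _ _ _ p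
    _ ≤ ENNReal.ofReal r := hint s hs t ht hst

/-- **`d_𝔽^{ℭ,J}(𝒳ⁿ, 𝒳ⁿ⁺¹) ≤ d_𝔽^{ℭⁿ,J}(𝒳ⁿ, 𝒳ⁿ⁺¹)`** for the combined correspondence `ℭ` of a
chain `(ℭⁿ)` (the source has equality; the inequality is what completeness uses).
[cite: Bamler2023, §5.4, proof of Thm. 5.19 (arXiv v1 Thm. 120)] -/
theorem fDistWithin_chainCorrespondence_pair_le (P : ℕ → MetricFlowPair.{u} I₀)
    (ℭ : ∀ n, Correspondence₂ (P n).flow (P (n + 1)).flow I₀) (n : ℕ) (J : Set ℝ) :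
    fDistWithinFamily P (chainCorrespondence ℭ) n (n + 1) J ≤
      fDistWithin (P n) (P (n + 1)) (ℭ n) J :=
  le_fDistWithin_iff.2 fun _ h ↦ fDistWithin_le (h.chainCorrespondence_pair ℭ)

/-- **A chain of correspondences becomes one correspondence between all the flows** (Bamler 2023,
§5.4, proof of Thm. 5.19: iterated Lemma 5.15, direct limit, completion): for metric flow pairs
`P n` over `I₀` and correspondences `ℭⁿ` between `(P n).flow, (P (n + 1)).flow` over `I₀`, all
fully defined over `J`, there is a correspondence `𝔇` between all the `(P n).flow` over `I₀` with
COMPLETE and SEPARABLE comparison spaces, fully defined over `J`, whose domains contain those of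
the `ℭⁿ` (`I''^{n,1} ⊆ I''^{,n}`, `I''^{n,2} ⊆ I''^{,n+1}`), and such that every radius admissible
for `d_𝔽^{ℭⁿ,J}(P n, P (n + 1))` is admissible for `d_𝔽^{𝔇,J}(P n, P (n + 1))` (so
`d_𝔽^{𝔇,J}(P n, P (n+1)) ≤ d_𝔽^{ℭⁿ,J}(P n, P (n+1))`).
[cite: Bamler2023, §5.4, proof of Thm. 5.19 (arXiv v1 Thm. 120)] -/
theorem exists_familyCorrespondence_of_chain {I₀ : Set ℝ} (P : ℕ → MetricFlowPair.{u} I₀)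
    (ℭ : ∀ n, Correspondence₂ (P n).flow (P (n + 1)).flow I₀) {J : Set ℝ}
    (hJ : ∀ n, (ℭ n).FullyDefinedOver J) :
    ∃ 𝔇 : FamilyCorrespondence (fun n ↦ (P n).flow) I₀,
      (∀ t, CompleteSpace (𝔇.Z t)) ∧ (∀ t, SeparableSpace (𝔇.Z t)) ∧ 𝔇.FullyDefinedOver J ∧
      (∀ n, (ℭ n).dom₁ ⊆ 𝔇.dom n) ∧ (∀ n, (ℭ n).dom₂ ⊆ 𝔇.dom (n + 1)) ∧
      ∀ n r, FDistAdmissible (P n) (P (n + 1)) (ℭ n) J r →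
        FDistAdmissible (P n) (P (n + 1)) (𝔇.pair n (n + 1)) J r :=
  ⟨chainCorrespondence ℭ, completeSpace_chainCorrespondence ℭ,
    separableSpace_chainCorrespondence ℭ, fullyDefinedOver_chainCorrespondence ℭ hJ,
    dom₁_subset_chainCorrespondence_dom ℭ, dom₂_subset_chainCorrespondence_dom ℭ,
    fun _ _ h ↦ h.chainCorrespondence_pair ℭ⟩

end MetricFlowPair

end Literature.Geometry.Riemannian

end
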